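import Mathlib
import Summits.KontsevichZagierPeriods.Zeta5Search.Families.DualCellBZChart
import HarnessLib

/-!
# ζ(5) search — Families: the INVERSE of Brown–Zudilin's chart — gap ratios of the dual cell as rational functions of `y` (P2 g7)

HONEST FRAMING: systematic search; no irrationality claim unless certified.  Cell `pub-zeta5`, prover P2 (g7, 2026-08-22).
Pure algebra over an arbitrary field; nothing about the arithmetic of `ζ(5)`; no number of record moves.

Step (S4) of the torus-homology proof of CONJECTURE D-exact (`HOME/pub-zeta5-p2/g7/DEXACT-PROOF.md`) inverts the chart
`w ↦ y` of `Families/DualCellBZChart` (`BZChart.yOf`): with `D₁ = y₁y₂y₃ − y₃ + 1`, `D₂ = y₃y₄y₅ − y₃ + 1`,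
`E = y₃(y₁y₂−1)(y₅−1) − 1`, `F = y₃(y₁y₂−1)(y₄y₅−1) − 1`, the gap ratios `u_k = g_k/g₀ = [k,k+1]/[01]` are
`u₁ = −D₁/(y₃y₅(y₁y₂−1))`, `u₂ = D₁E/(y₃y₅(y₁y₂−1)F)`, `u₃ = −D₁D₂E/(y₁y₂y₃y₅F)`, `u₄ = D₁E/(y₁y₂y₃y₅(y₂−1))`,
`u₅ = −D₁E/(y₁y₃y₅(y₂−1))`.  Here this is a KERNEL identity: substituting `y = yOf w` (injective `w`) into these five
rational functions returns exactly `(w_{k+1} − w_k)/(w₁ − w₀)` (`uOfY_yOf`; on the way `E = [26]/[12]`, `F = −[26]/[23]`).  The analytic remainder of (S4) — the initial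
forms of these functions on the residue torus `|y₃| = ε, |y_{1,2,4,5}| = 1/ε` and the degree `det M = −1` — stays on paper.
Standard axioms only.
-/

namespace Summit.KontsevichZagierPeriods.Zeta5Search.Families.Cellular
namespace BZChart

variable {K : Type*} [Field K]

/-- `D₁ = y₁y₂y₃ − y₃ + 1` (= `1 − y₃(1 − y₁y₂)`). -/
def dOne (y : Fin 5 → K) : K := y 0 * y 1 * y 2 - y 2 + 1
/-- `D₂ = y₃y₄y₅ − y₃ + 1`. -/
def dTwo (y : Fin 5 → K) : K := y 2 * y 3 * y 4 - y 2 + 1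
/-- `E = y₃(y₁y₂ − 1)(y₅ − 1) − 1`. -/
def eAux (y : Fin 5 → K) : K := y 2 * (y 0 * y 1 - 1) * (y 4 - 1) - 1
/-- `F = y₃(y₁y₂ − 1)(y₄y₅ − 1) − 1`. -/
def fAux (y : Fin 5 → K) : K := y 2 * (y 0 * y 1 - 1) * (y 3 * y 4 - 1) - 1

/-- The inverse chart: the five gap ratios `u_k = g_k/g₀` of the dual cell as rational functions of BZ's `y`. -/
def uOfY (y : Fin 5 → K) : Fin 5 → K :=
  ![-dOne y / (y 2 * y 4 * (y 0 * y 1 - 1)),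
    dOne y * eAux y / (y 2 * y 4 * (y 0 * y 1 - 1) * fAux y),
    -(dOne y * dTwo y * eAux y) / (y 0 * y 1 * y 2 * y 4 * fAux y),
    dOne y * eAux y / (y 0 * y 1 * y 2 * y 4 * (y 1 - 1)),
    -(dOne y * eAux y) / (y 0 * y 2 * y 4 * (y 1 - 1))]

section inverse

variable {w : Fin 7 → K}

/-- Distinct points have non-zero differences. -/
private theorem sne' (hw : Function.Injective w) {i j : Fin 7} (h : i ≠ j) : w i - w j ≠ 0 :=
  sub_ne_zero.mpr (hw.ne h)

/-- `D₁(yOf w) = −[26]/[02]` (same as `D1_eq`, in the polynomial spelling of this file). -/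
theorem dOne_yOf (hw : Function.Injective w) : dOne (yOf w) = -(w 6 - w 2) / (w 2 - w 0) := by
  rw [dOne, yOf_eq hw]; simp
  field_simp (disch := first | assumption | exact sne' hw (by decide)); ring

/-- `D₂(yOf w) = −[26][34]/([23][46])`. -/
theorem dTwo_yOf (hw : Function.Injective w) :
    dTwo (yOf w) = -((w 6 - w 2) * (w 4 - w 3)) / ((w 3 - w 2) * (w 6 - w 4)) := by
  rw [dTwo, yOf_eq hw]; simp
  field_simp (disch := first | assumption | exact sne' hw (by decide)); ring

/-- `E(yOf w) = [26]/[12]`. -/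
theorem eAux_yOf (hw : Function.Injective w) : eAux (yOf w) = (w 6 - w 2) / (w 2 - w 1) := by
  rw [eAux, yOf_eq hw]; simp
  field_simp (disch := first | assumption | exact sne' hw (by decide)); ring

/-- `F(yOf w) = −[26]/[23]`. -/
theorem fAux_yOf (hw : Function.Injective w) : fAux (yOf w) = -(w 6 - w 2) / (w 3 - w 2) := by
  rw [fAux, yOf_eq hw]; simp
  field_simp (disch := first | assumption | exact sne' hw (by decide)); ring

/-- `y₁y₂ − 1 = [46]/[24]` on the chart. -/
theorem y01_sub_one (hw : Function.Injective w) : yOf w 0 * yOf w 1 - 1 = (w 6 - w 4) / (w 4 - w 2) := by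
  rw [yOf_eq hw]; simp
  field_simp (disch := first | assumption | exact sne' hw (by decide)); ring

/-- `y₂ − 1 = −[46]/[45]` on the chart. -/
theorem y1_sub_one (hw : Function.Injective w) : yOf w 1 - 1 = -(w 6 - w 4) / (w 5 - w 4) := by
  rw [yOf_eq hw]; simp
  field_simp (disch := first | assumption | exact sne' hw (by decide)); ring

/-- **The inverse chart is correct:** `uOfY (yOf w) k = [k,k+1]/[01]` for `k = 1,…,5` (injective `w`). -/
theorem uOfY_yOf (hw : Function.Injective w) : uOfY (yOf w) =
    ![(w 2 - w 1) / (w 1 - w 0), (w 3 - w 2) / (w 1 - w 0), (w 4 - w 3) / (w 1 - w 0), (w 5 - w 4) / (w 1 - w 0),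
      (w 6 - w 5) / (w 1 - w 0)] := by
  unfold uOfY
  rw [dOne_yOf hw, dTwo_yOf hw, eAux_yOf hw, fAux_yOf hw, y01_sub_one hw, y1_sub_one hw, yOf_eq hw]
  ext i; fin_cases i <;> simp <;> field_simp (disch := first | assumption | exact sne' hw (by decide)) <;> ring

end inverse

end BZChart
end Summit.KontsevichZagierPeriods.Zeta5Search.Families.Cellular
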